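import Mathlib
import Summits.KontsevichZagierPeriods.Zeta5Search.RhoResidueIdentitiesProof
import Summits.KontsevichZagierPeriods.Zeta5Search.UniversalDigitW
import Summits.KontsevichZagierPeriods.Zeta5Search.KDigitWeights
import HarnessLib

/-!
# ζ(5) search — the universal first digit of `𝒦_x` is a THEOREM (`KDigit`, gen-2 g9's U-K)

Cell `pub-zeta5` (HONEST FRAMING: systematic search; no irrationality claim unless certified), typer seat
generation 9.  Discharges BY NAME `KDigit` (`Zeta5Search/UniversalDigit.lean` §2; REPORT-gen2-g9 §1.3; exact check 104,951
classes): for a residue class `x` with a pole `q` and `E_x ≤ −3`,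
**`v_p(𝒦_x − (−p)^{E_x+1} p² ĝ_q ĉ_x) ≥ E_x + 4`**, `ĉ_x = Σ_{poles} (ℓ²ρ₁ + 2ℓρ₂)` (`cHat`).

PROOF (gen-2's, REPORT-gen2-g9 §1.3).  In `𝒦_x = Σ_{s∈x} Σ_o c_{o,s}(g_o(s+1) − [o=2])` only `o ∈ {0,1}` reach the order
`E+3`: Theorem A (`clusterBound_holds`) and `p ∣ g_o − [o=2]` dispose of `o ≥ 2`; for `o = 0, 1` Theorem B
(`leadingDigit_holds`: `c_{0,s} ≈ (−p)^{E+1}ĝ_sρ_{s,1}`, `c_{1,s} ≈ (−p)^{E+2}ĝ_sρ_{s,2}`), `ĝ_s ≡ ĝ_q` (G1), and the weights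
`g₀ = p²φ²`, `g₁ ≡ 2pφ (mod p²)`, `φ_{s+1} ≡ φ_{x+1} − ℓ_s (mod p)` (`KDigitWeights.lean`) give
`𝒦_x ≡ (−p)^{E+1}p² ĝ_q Σ_s [ρ_{s,1}(φ − ℓ_s)² − 2ρ_{s,2}(φ − ℓ_s)] (mod p^{E+4})`, and the bracket sum equals `ĉ_x` EXACTLY by the
residue identities `Σρ₁ = 0`, `Σ(ρ₂ + ℓρ₁) = 0` (`rhoResidueIdentities_holds`, which need `E_x ≤ −3`): the Fermat quotient `φ`
cancels.  `p`-adic valuations of rational numbers; nothing about irrationality.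
-/

noncomputable section

open Finset

namespace Summit.KontsevichZagierPeriods.Zeta5Search.ClusterValuation

open Summit.KontsevichZagierPeriods.Zeta5Search.DualSeries (InBox)
open Summit.KontsevichZagierPeriods.Zeta5Search.WedgeDictionary (pfData)
open Summit.KontsevichZagierPeriods.Zeta5Search.CasoratianValuation (InPolytope)
open Summit.KontsevichZagierPeriods.Zeta5Search.PadicSeries

variable {p : ℕ} [hp : Fact p.Prime]

/-! ### The Fermat quotient cancels: `Σ_s [ρ₁(φ − ℓ_s)² − 2ρ₂(φ − ℓ_s)] = ĉ_x` -/

omit hp in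
/-- For ANY `φ`, `Σ_{poles} [ρ_{s,1}(φ − ℓ_s)² − 2ρ_{s,2}(φ − ℓ_s)] = ĉ_x`, given the two residue identities. -/
theorem cHat_eq_sum_shift (b : ℕ → ℤ) (p x : ℕ) (φ : ℚ)
    (hS1 : ∑ q ∈ classPoles b p x, classRho b p q 1 = 0)
    (hS2 : ∑ q ∈ classPoles b p x,
      ((if netExp b q ≤ -2 then classRho b p q 2 else 0) + ((q / p : ℕ) : ℚ) * classRho b p q 1) = 0) :
    cHat b p x = ∑ q ∈ classPoles b p x,
      (classRho b p q 1 * (φ - ((q / p : ℕ) : ℚ)) ^ 2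
        - 2 * (if netExp b q ≤ -2 then classRho b p q 2 else 0) * (φ - ((q / p : ℕ) : ℚ))) := by
  have h : ∀ q ∈ classPoles b p x,
      (classRho b p q 1 * (φ - ((q / p : ℕ) : ℚ)) ^ 2
        - 2 * (if netExp b q ≤ -2 then classRho b p q 2 else 0) * (φ - ((q / p : ℕ) : ℚ))) =
      ((((q / p : ℕ) : ℚ)) ^ 2 * classRho b p q 1
          + (if netExp b q ≤ -2 then 2 * ((q / p : ℕ) : ℚ) * classRho b p q 2 else 0))
        + (φ ^ 2 * classRho b p q 1
          - 2 * φ * ((if netExp b q ≤ -2 then classRho b p q 2 else 0) + ((q / p : ℕ) : ℚ) * classRho b p q 1)) := by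
    intro q _
    split_ifs <;> ring
  rw [sum_congr rfl h, sum_add_distrib, sum_sub_distrib, ← mul_sum, ← mul_sum, hS1, hS2, cHat]
  ring

/-! ### Norm bookkeeping -/

/-- `‖(−p)^e‖_p = p^{−e}`. -/
theorem padicNorm_neg_p_zpow (e : ℤ) : padicNorm p ((-(p : ℚ)) ^ e) ≤ (p : ℚ) ^ (-e) := by
  have hp' : (-(p : ℚ)) ≠ 0 := neg_ne_zero.2 (Nat.cast_ne_zero.2 hp.out.ne_zero)
  rw [padicNorm.eq_zpow_of_nonzero (zpow_ne_zero _ hp'), padicValRat.zpow, padicValRat.neg,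
    padicValRat.self hp.out.one_lt, mul_one]

/-- `‖−p‖_p ≤ p^{−1}`. -/
theorem padicNorm_neg_p_le : padicNorm p (-(p : ℚ)) ≤ (p : ℚ) ^ (-(1 : ℤ)) := by
  rw [padicNorm.neg, padicNorm.padicNorm_p_of_prime, zpow_neg, zpow_one]

/-- `‖p‖_p ≤ p^{−1}`. -/
theorem padicNorm_p_le' : padicNorm p ((p : ℚ)) ≤ (p : ℚ) ^ (-(1 : ℤ)) := by
  rw [padicNorm.padicNorm_p_of_prime, zpow_neg, zpow_one]

/-- `‖p²‖_p ≤ p^{−2}`. -/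
theorem padicNorm_p_sq_le : padicNorm p ((p : ℚ) ^ 2) ≤ (p : ℚ) ^ (-(2 : ℤ)) := by
  rw [pow_two, show (-(2 : ℤ)) = -1 + -1 by norm_num]
  exact padicNorm_mul_le padicNorm_p_le' padicNorm_p_le'

omit hp in
/-- `‖x‖ ≤ 1` as `‖x‖ ≤ p^0`. -/
theorem padicNorm_le_zpow_zero {x : ℚ} (h : padicNorm p x ≤ 1) : padicNorm p x ≤ (p : ℚ) ^ (0 : ℤ) := by
  rwa [zpow_zero]

omit hp in
/-- In the class of `x < p`: `s + 1 = (x + 1) + p·ℓ_s`. -/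
theorem succ_eq_succ_add_mul_lvl {b : ℕ → ℤ} {x s : ℕ} (hx : x < p) (hs : s ∈ classSet b p x) :
    ((s : ℤ) + 1) = ((x : ℤ) + 1) + (p : ℤ) * (((s / p : ℕ) : ℤ)) := by
  have hres : s % p = x % p := (mem_filter.1 hs).2
  rw [Nat.mod_eq_of_lt hx] at hres
  have := Nat.div_add_mod s p
  have h : s + 1 = x + 1 + p * (s / p) := by omega
  exact_mod_cast h

/-! ### The three kinds of terms of `𝒦_x` -/

section Terms

variable (b : ℕ → ℤ) (hb : InPolytope b) (hp5 : 5 ≤ p) (hwin : (b 0 + 2 : ℤ) < (p : ℤ) ^ 2)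
  {x q s : ℕ} (hx : x < p) (hq : q ∈ classSet b p x) (hs : s ∈ classSet b p x)
include hb hp5 hwin hx hq hs

omit hx hq in
/-- `o ≥ 2`: `‖c_{o,s}(g_o − [o=2])‖ ≤ p^{−(E+4)}` (Theorem A and `p ∣ g_o − [o=2]`). -/
theorem kDigit_term_high {o : ℕ} (ho : o < 6) (h2 : 2 ≤ o) :
    padicNorm p (pfData b o s * (((taylorTT p o ((s : ℤ) + 1) : ℤ) : ℚ) - if o = 2 then 1 else 0))
      ≤ (p : ℚ) ^ (-(classExp b p x + 4)) := by
  have hprime := hp.out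
  have hsn : s ≤ (b 0).toNat := le_of_mem_classSet b hs
  by_cases h0 : pfData b o s = 0
  · rw [h0, zero_mul, padicNorm.zero]; exact zpow_p_nonneg _
  have hA := clusterBound_holds b p s o hb hprime (by omega) hwin hsn ho h0
  rw [classExp_eq_of_mem hs] at hA
  have hc : padicNorm p (pfData b o s) ≤ (p : ℚ) ^ (-((o : ℤ) + 1 + classExp b p x)) :=
    padicNorm_le_of_val fun _ => hA
  exact (padicNorm_mul_le hc (padicNorm_taylorTT_sub_le hp5 ho _)).trans (zpow_le_zpow_right₀ one_le_p (by omega))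

/-- `o = 0`: `‖c_{0,s}·g₀(s+1) − (−p)^{E+1}p² ĝ_q ρ_{s,1}(φ − ℓ_s)²‖ ≤ p^{−(E+4)}` at a pole `s`. -/
theorem kDigit_term_zero (hspole : netExp b s < 0) :
    padicNorm p (pfData b 0 s * (((taylorTT p 0 ((s : ℤ) + 1) : ℤ) : ℚ) - if 0 = 2 then 1 else 0)
      - (-(p : ℚ)) ^ (classExp b p x + 1) * (p : ℚ) ^ 2 * gHat b p q *
        (classRho b p s 1 * ((fq p ((x : ℤ) + 1) : ℚ) - ((s / p : ℕ) : ℚ)) ^ 2))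
      ≤ (p : ℚ) ^ (-(classExp b p x + 4)) := by
  have hprime := hp.out
  obtain ⟨-, -, -, hn⟩ := thmA_data b hb hwin
  have h0 : 0 ≤ b 0 := hb.1.1
  have hp2 : p ≠ 2 := by omega
  have hsn : s ≤ (b 0).toNat := le_of_mem_classSet b hs
  have hEs : classExp b p s = classExp b p x := classExp_eq_of_mem hs
  set E := classExp b p x with hE
  set P := (-(p : ℚ)) ^ (E + 1) with hP
  set φs : ℚ := (fq p ((s : ℤ) + 1) : ℚ) with hφs
  set A : ℚ := (fq p ((x : ℤ) + 1) : ℚ) - ((s / p : ℕ) : ℚ) with hA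
  -- Theorem B at `σ = 1`
  have hB : padicNorm p (pfData b 0 s - P * gHat b p s * classRho b p s 1) ≤ (p : ℚ) ^ (-(E + 2)) := by
    refine padicNorm_le_of_val fun hne' => ?_
    have := leadingDigit_holds b p s 1 hb hprime hp5 hwin hsn le_rfl (by push_cast; omega)
      (by rw [hEs, show ((1 : ℕ) : ℤ) + E = E + 1 by ring]; exact hne')
    rw [hEs, show ((1 : ℕ) : ℤ) + E = E + 1 by ring] at this
    push_cast at this ⊢
    linarith
  have hPn : padicNorm p P ≤ (p : ℚ) ^ (-(E + 1)) := padicNorm_neg_p_zpow _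
  have hgq : padicNorm p (gHat b p q) ≤ (p : ℚ) ^ (0 : ℤ) := by
    refine padicNorm_le_zpow_zero ?_
    by_cases h0' : gHat b p q = 0
    · rw [h0', padicNorm.zero]; exact zero_le_one
    · have := (CellA.gHat_classCongr b p x q q hb hprime hp5 hx hq hq).1
      rw [padicNorm.eq_zpow_of_nonzero h0', this, neg_zero, zpow_zero]
  have hgg : padicNorm p (gHat b p s - gHat b p q) ≤ (p : ℚ) ^ (-(1 : ℤ)) :=
    padicNorm_le_of_val fun hne' => (CellA.gHat_classCongr b p x s q hb hprime hp5 hx hs hq).2 (sub_ne_zero.1 hne')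
  have hρ : padicNorm p (classRho b p s 1) ≤ (p : ℚ) ^ (0 : ℤ) :=
    padicNorm_le_zpow_zero (CellA.padicNorm_classRho_le_one b h0 hsn hn hp2 1)
  have hφ : padicNorm p (φs ^ 2) ≤ (p : ℚ) ^ (0 : ℤ) := by
    refine padicNorm_le_zpow_zero ?_
    rw [pow_two, padicNorm.mul]
    exact mul_le_one₀ (padicNorm_fq_le_one _) (padicNorm.nonneg _) (padicNorm_fq_le_one _)
  have hshift : padicNorm p (φs ^ 2 - A ^ 2) ≤ (p : ℚ) ^ (-(1 : ℤ)) := by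
    have := padicNorm_fq_shift_sq_le (p := p) ((x : ℤ) + 1) (((s / p : ℕ) : ℤ))
    rw [← succ_eq_succ_add_mul_lvl hx hs] at this
    push_cast at this
    exact this
  -- the decomposition
  rw [if_neg (by decide), sub_zero, taylorTT_zero_cast hp2]
  have e : pfData b 0 s * ((p : ℚ) ^ 2 * φs ^ 2) - P * (p : ℚ) ^ 2 * gHat b p q * (classRho b p s 1 * A ^ 2) =
      (pfData b 0 s - P * gHat b p s * classRho b p s 1) * (p : ℚ) ^ 2 * φs ^ 2
        + (P * (gHat b p s - gHat b p q) * classRho b p s 1 * (p : ℚ) ^ 2 * φs ^ 2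
          + P * (p : ℚ) ^ 2 * gHat b p q * classRho b p s 1 * (φs ^ 2 - A ^ 2)) := by
    ring
  rw [e]
  refine (padicNorm.nonarchimedean (p := p)).trans (max_le ?_ ((padicNorm.nonarchimedean (p := p)).trans (max_le ?_ ?_)))
  · exact (padicNorm_mul_le (padicNorm_mul_le hB padicNorm_p_sq_le) hφ).trans
      (zpow_le_zpow_right₀ one_le_p (by omega))
  · exact (padicNorm_mul_le (padicNorm_mul_le (padicNorm_mul_le (padicNorm_mul_le hPn hgg) hρ) padicNorm_p_sq_le) hφ).trans
      (zpow_le_zpow_right₀ one_le_p (by omega))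
  · exact (padicNorm_mul_le (padicNorm_mul_le (padicNorm_mul_le (padicNorm_mul_le hPn padicNorm_p_sq_le) hgq) hρ)
      hshift).trans (zpow_le_zpow_right₀ one_le_p (by omega))

/-- `o = 1`: `‖c_{1,s}·g₁(s+1) + (−p)^{E+1}p² ĝ_q · 2ρ_{s,2}(φ − ℓ_s)‖ ≤ p^{−(E+4)}` at a pole `s` (`ρ_{s,2} := 0` for a simple pole). -/
theorem kDigit_term_one (hspole : netExp b s < 0) :
    padicNorm p (pfData b 1 s * (((taylorTT p 1 ((s : ℤ) + 1) : ℤ) : ℚ) - if 1 = 2 then 1 else 0)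
      + (-(p : ℚ)) ^ (classExp b p x + 1) * (p : ℚ) ^ 2 * gHat b p q *
        (2 * (if netExp b s ≤ -2 then classRho b p s 2 else 0) * ((fq p ((x : ℤ) + 1) : ℚ) - ((s / p : ℕ) : ℚ))))
      ≤ (p : ℚ) ^ (-(classExp b p x + 4)) := by
  have hprime := hp.out
  obtain ⟨-, -, -, hn⟩ := thmA_data b hb hwin
  have h0 : 0 ≤ b 0 := hb.1.1
  have hp2 : p ≠ 2 := by omega
  have hp' : (-(p : ℚ)) ≠ 0 := neg_ne_zero.2 (Nat.cast_ne_zero.2 hprime.ne_zero)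
  have hsn : s ≤ (b 0).toNat := le_of_mem_classSet b hs
  have hEs : classExp b p s = classExp b p x := classExp_eq_of_mem hs
  set E := classExp b p x with hE
  set P := (-(p : ℚ)) ^ (E + 1) with hP
  set φs : ℚ := (fq p ((s : ℤ) + 1) : ℚ) with hφs
  set A : ℚ := (fq p ((x : ℤ) + 1) : ℚ) - ((s / p : ℕ) : ℚ) with hA
  set g1 : ℚ := ((taylorTT p 1 ((s : ℤ) + 1) : ℤ) : ℚ) with hg1
  rw [if_neg (by decide), sub_zero]
  by_cases h2 : netExp b s ≤ -2
  · rw [if_pos h2]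
    -- Theorem B at `σ = 2`
    have hP2 : (-(p : ℚ)) ^ (E + 2) = P * (-(p : ℚ)) := by
      rw [show E + 2 = E + 1 + 1 by ring, zpow_add_one₀ hp']
    have hB : padicNorm p (pfData b 1 s - P * (-(p : ℚ)) * gHat b p s * classRho b p s 2) ≤ (p : ℚ) ^ (-(E + 3)) := by
      rw [← hP2]
      refine padicNorm_le_of_val fun hne' => ?_
      have := leadingDigit_holds b p s 2 hb hprime hp5 hwin hsn (by norm_num) (by push_cast; omega)
        (by rw [hEs, show ((2 : ℕ) : ℤ) + E = E + 2 by ring]; exact hne')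
      rw [hEs, show ((2 : ℕ) : ℤ) + E = E + 2 by ring] at this
      push_cast at this ⊢
      linarith
    have hPn : padicNorm p P ≤ (p : ℚ) ^ (-(E + 1)) := padicNorm_neg_p_zpow _
    have hgq : padicNorm p (gHat b p q) ≤ (p : ℚ) ^ (0 : ℤ) := by
      refine padicNorm_le_zpow_zero ?_
      by_cases h0' : gHat b p q = 0
      · rw [h0', padicNorm.zero]; exact zero_le_one
      · have := (CellA.gHat_classCongr b p x q q hb hprime hp5 hx hq hq).1
        rw [padicNorm.eq_zpow_of_nonzero h0', this, neg_zero, zpow_zero]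
    have hgg : padicNorm p (gHat b p s - gHat b p q) ≤ (p : ℚ) ^ (-(1 : ℤ)) :=
      padicNorm_le_of_val fun hne' => (CellA.gHat_classCongr b p x s q hb hprime hp5 hx hs hq).2 (sub_ne_zero.1 hne')
    have hρ : padicNorm p (classRho b p s 2) ≤ (p : ℚ) ^ (0 : ℤ) :=
      padicNorm_le_zpow_zero (CellA.padicNorm_classRho_le_one b h0 hsn hn hp2 2)
    have hg : padicNorm p g1 ≤ (p : ℚ) ^ (-(1 : ℤ)) := padicNorm_taylorTT_one_le hp5 _
    have hgφ : padicNorm p (g1 - 2 * (p : ℚ) * φs) ≤ (p : ℚ) ^ (-(2 : ℤ)) := padicNorm_taylorTT_one_sub_le hp2 _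
    have h2n : padicNorm p (2 : ℚ) ≤ (p : ℚ) ^ (0 : ℤ) := by
      refine padicNorm_le_zpow_zero ?_
      have := padicNorm.of_int (p := p) 2
      exact_mod_cast this
    have hshift : padicNorm p (φs - A) ≤ (p : ℚ) ^ (-(1 : ℤ)) := by
      have := padicNorm_fq_shift_le (p := p) ((x : ℤ) + 1) (((s / p : ℕ) : ℤ))
      rw [← succ_eq_succ_add_mul_lvl hx hs] at this
      push_cast at this
      exact this
    have e : pfData b 1 s * g1 + P * (p : ℚ) ^ 2 * gHat b p q * (2 * classRho b p s 2 * A) =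
        (pfData b 1 s - P * (-(p : ℚ)) * gHat b p s * classRho b p s 2) * g1
          + (P * (-(p : ℚ)) * (gHat b p s - gHat b p q) * classRho b p s 2 * g1
            + (P * (-(p : ℚ)) * gHat b p q * classRho b p s 2 * (g1 - 2 * (p : ℚ) * φs)
              + P * (-(p : ℚ)) * gHat b p q * classRho b p s 2 * (2 * (p : ℚ) * (φs - A)))) := by
      ring
    rw [e]
    refine (padicNorm.nonarchimedean (p := p)).trans (max_le ?_ ((padicNorm.nonarchimedean (p := p)).trans
      (max_le ?_ ((padicNorm.nonarchimedean (p := p)).trans (max_le ?_ ?_)))))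
    · exact (padicNorm_mul_le hB hg).trans (zpow_le_zpow_right₀ one_le_p (by omega))
    · exact (padicNorm_mul_le (padicNorm_mul_le (padicNorm_mul_le (padicNorm_mul_le hPn padicNorm_neg_p_le) hgg) hρ)
        hg).trans (zpow_le_zpow_right₀ one_le_p (by omega))
    · exact (padicNorm_mul_le (padicNorm_mul_le (padicNorm_mul_le (padicNorm_mul_le hPn padicNorm_neg_p_le) hgq) hρ)
        hgφ).trans (zpow_le_zpow_right₀ one_le_p (by omega))
    · exact (padicNorm_mul_le (padicNorm_mul_le (padicNorm_mul_le (padicNorm_mul_le hPn padicNorm_neg_p_le) hgq) hρ)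
        (padicNorm_mul_le (padicNorm_mul_le h2n padicNorm_p_le') hshift)).trans (zpow_le_zpow_right₀ one_le_p (by omega))
  · -- simple pole: `c_{1,s} = 0` and no `ρ₂` term
    rw [if_neg h2, CellA.pfData_eq_zero_of_order_le b hb hsn (by norm_num) (by push_cast; omega)]
    simp only [zero_mul, mul_zero, add_zero, padicNorm.zero]
    exact zpow_p_nonneg _

/-- **All terms together**: `‖𝒦_{x,s} − (−p)^{E+1}p² ĝ_q·[s pole]·(ρ₁(φ−ℓ_s)² − 2ρ₂(φ−ℓ_s))‖ ≤ p^{−(E+4)}` for every class point `s`. -/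
theorem kDigit_term :
    padicNorm p ((∑ o ∈ range 6, pfData b o s * (((taylorTT p o ((s : ℤ) + 1) : ℤ) : ℚ) - if o = 2 then 1 else 0))
      - (-(p : ℚ)) ^ (classExp b p x + 1) * (p : ℚ) ^ 2 * gHat b p q *
        (if netExp b s < 0 then
          (classRho b p s 1 * ((fq p ((x : ℤ) + 1) : ℚ) - ((s / p : ℕ) : ℚ)) ^ 2
            - 2 * (if netExp b s ≤ -2 then classRho b p s 2 else 0) * ((fq p ((x : ℤ) + 1) : ℚ) - ((s / p : ℕ) : ℚ)))
         else 0)) ≤ (p : ℚ) ^ (-(classExp b p x + 4)) := by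
  have hsn : s ≤ (b 0).toNat := le_of_mem_classSet b hs
  by_cases hspole : netExp b s < 0
  · rw [if_pos hspole, ← add_sum_erase (range 6) _ (show 0 ∈ range 6 by simp),
      ← add_sum_erase ((range 6).erase 0) _ (show 1 ∈ (range 6).erase 0 by simp)]
    set R := ∑ o ∈ ((range 6).erase 0).erase 1,
      pfData b o s * (((taylorTT p o ((s : ℤ) + 1) : ℤ) : ℚ) - if o = 2 then 1 else 0) with hR
    have hRle : padicNorm p R ≤ (p : ℚ) ^ (-(classExp b p x + 4)) := by
      refine padicNorm.sum_le' (fun o ho => ?_) (zpow_p_nonneg _)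
      simp only [mem_erase, mem_range] at ho
      exact kDigit_term_high b hb hp5 hwin hs ho.2.2 (by omega)
    have e : ∀ (f0 f1 M r1 r2 A : ℚ), f0 + (f1 + R) - M * (r1 * A ^ 2 - 2 * r2 * A) =
        R + ((f1 + M * (2 * r2 * A)) + (f0 - M * (r1 * A ^ 2))) := by
      intros; ring
    rw [e]
    exact (padicNorm.nonarchimedean (p := p)).trans (max_le hRle ((padicNorm.nonarchimedean (p := p)).trans
      (max_le (kDigit_term_one b hb hp5 hwin hx hq hs hspole) (kDigit_term_zero b hb hp5 hwin hx hq hs hspole))))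
  · rw [if_neg hspole, mul_zero, sub_zero, sum_eq_zero (fun o ho => by
      rw [pfData_eq_zero_of_netExp_nonneg b hb hsn (by omega) (mem_range.1 ho), zero_mul]), padicNorm.zero]
    exact zpow_p_nonneg _

end Terms

/-! ### U-K -/

/-- **`KDigit` is a theorem** (gen-2 g9's U-K: the first digit of `𝒦_x` is `ĝ_q ĉ_x`, for `E_x ≤ −3`). -/
theorem kDigit_holds : KDigit := by
  intro b p x q hb hprime hp5 hwin hx hq _hqpole hE hne
  haveI : Fact p.Prime := ⟨hprime⟩
  have hp0 : 0 < p := hprime.pos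
  obtain ⟨hS1, hS2, -⟩ := rhoResidueIdentities_holds b p x hb hprime hp5 hwin hx
  have hc := cHat_eq_sum_shift b p x ((fq p ((x : ℤ) + 1) : ℚ)) (hS1 (by omega)) (hS2 hE)
  have hsplit : classK b p x - (-(p : ℚ)) ^ (classExp b p x + 1) * (p : ℚ) ^ 2 * gHat b p q * cHat b p x =
      ∑ s ∈ classSet b p x,
        ((∑ o ∈ range 6, pfData b o s * (((taylorTT p o ((s : ℤ) + 1) : ℤ) : ℚ) - if o = 2 then 1 else 0))
          - (-(p : ℚ)) ^ (classExp b p x + 1) * (p : ℚ) ^ 2 * gHat b p q *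
            (if netExp b s < 0 then
              (classRho b p s 1 * ((fq p ((x : ℤ) + 1) : ℚ) - ((s / p : ℕ) : ℚ)) ^ 2
                - 2 * (if netExp b s ≤ -2 then classRho b p s 2 else 0) * ((fq p ((x : ℤ) + 1) : ℚ) - ((s / p : ℕ) : ℚ)))
             else 0)) := by
    rw [hc, classPoles, sum_filter, mul_sum, classK, ← sum_sub_distrib]
  apply val_ge_of_padicNorm_le hne
  rw [hsplit]
  exact padicNorm.sum_le' (fun s hs => kDigit_term b hb hp5 hwin hx hq hs) (zpow_p_nonneg _)

end Summit.KontsevichZagierPeriods.Zeta5Search.ClusterValuation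

end
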